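import Summits.Parity.BatemanHorn.Theorems.SoloInformedPolynomialUpperBoundSieve
import Summits.Parity.BatemanHorn.Theorems.SoloInformedQuadraticSquares
import Literature.NumberTheory.Sieve.IwaniecAlmostPrimesQuadraticMertens
import Literature.NumberTheory.Sieve.PolynomialCongruencesMeanValues
import Literature.NumberTheory.Sieve.ParityBatemanHorn
import Literature.Barriers.Parity.UniformBatemanHornBunyakovsky

/-!
# The classical upper-bound sieve wall for every quadratic Bateman–Horn polynomial

Solo unit `solo-Parity-informed` (ideation tier, informed mode), session 12; `PLAN.md` §20.5, CLAIMS C55.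

For ONE polynomial `g ∈ ℤ[X]` of degree `2` forming a Bateman–Horn system (irreducible, positive leading
coefficient, no fixed prime divisor) the Bateman–Horn conjecture predicts
`π_g(N) = #{n ≤ N : g(n) prime} ~ C(g) N / (2 log N)`. This file proves the unconditional upper bound

* `eventually_polyPrimeCount_le_of_natDegree_two` — `π_g(N) ≤ (2 C(g) + δ) N / log N` for every
  `δ > 0` and all large `N`,

four times the prediction: Halberstam–Richert, *Sieve Methods*, Thm 5.3 in degree `2`, with the
constant of the Jurkat–Richert linear sieve (`F(1) = 2e^γ`, level `N^{1-o(1)}`). It generalises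
`eventually_nSqAddOnePrimeCount_le` (`g = X² + 1`, `SoloInformedUpperBoundSieve`) to all quadratics.

Proof. Write `g = aX² + bX + c`. A translate `f(X) = g(X + n₀)` with `n₀ ≥ |b| + |c| + 1` and `g(n₀)`
odd (possible because `2` is not a fixed divisor) has the same local root counts `ρ_f = ρ_g`
(`Literature.Barriers.Parity.polyRootCountMod_comp_X_add_C`), values `f(n) = g(n + n₀) ≥ n`, and is a
quadratic `aX² + b'X + c'` with `c'` odd, so the tree's sieve condition
`Iwaniec1978.rhoG_sieveConditionOne` applies to it; the generic layer
`SoloInformedPolynomialUpperBoundSieve` (Jurkat–Richert bound, remainders `|R_d| ≤ ρ(d)` with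
`∑_{m ≤ y} ρ_g(m) ≪ y` from `exists_sum_rootCount_le`, main term from the Bateman–Horn Mertens product)
then bounds `#{n ≤ N : |f(n)| prime}`, and `π_g(N) ≤ #{n ≤ N : |f(n)| prime} + n₀ + 1`.

References: H. Halberstam, H.-E. Richert, *Sieve Methods* (Academic Press 1974) Thm 5.3; W. B. Jurkat,
H.-E. Richert, Acta Arith. 11 (1965) 217–240; H. Iwaniec, Invent. Math. 47 (1978) 171–188
[IwaniecInventiones1978]; P. T. Bateman, R. A. Horn, Math. Comp. 16 (1962) 363–367 [BatemanHorn1962].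
-/

namespace Summit.Parity.BatemanHorn.Theorems

open Finset Filter Asymptotics Polynomial
open scoped Topology
open Literature.NumberTheory.Sieve (polyRootCountMod IsBatemanHornSystem batemanHornConst polyPrimeCount
  exists_sum_rootCount_le)
open Literature.NumberTheory.Sieve.Iwaniec1978 (quadPoly eval_quadPoly rhoG rhoG_sieveConditionOne)
open Literature.NumberTheory.Sieve.BatemanHornMertens (rootCount_single_lt)
open Literature.Barriers.Parity (polyRootCountMod_comp_X_add_C irreducible_comp_X_add_C)

/-! ### A good translate of a quadratic Bateman–Horn polynomial -/

/-- For `g = aX² + bX + c` of degree `2` forming a Bateman–Horn system there is a shift `n₀` with `g(n₀)`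
odd (the prime `2` is not a fixed divisor, and `g(n) mod 2` has period `2`) and `g(m) ≥ m` for all
`m ≥ n₀` (any `n₀ ≥ |b| + |c| + 1` does, as `a ≥ 1`). -/
theorem exists_oddShift_of_natDegree_two {g : ℤ[X]} (hg : IsBatemanHornSystem ![g])
    (hdeg : g.natDegree = 2) :
    ∃ n₀ : ℕ, ¬ (2 : ℤ) ∣ g.eval (n₀ : ℤ) ∧ ∀ m : ℤ, (n₀ : ℤ) ≤ m → m ≤ g.eval m := by
  obtain ⟨a, ha_def⟩ : ∃ a : ℤ, a = g.coeff 2 := ⟨_, rfl⟩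
  obtain ⟨b, hb_def⟩ : ∃ b : ℤ, b = g.coeff 1 := ⟨_, rfl⟩
  obtain ⟨c, hc_def⟩ : ∃ c : ℤ, c = g.coeff 0 := ⟨_, rfl⟩
  have hquad : g = quadPoly a b c := by
    rw [ha_def, hb_def, hc_def]; exact eq_quadratic_of_natDegree_le_two g hdeg.le
  have ha : 0 < a := by
    have h := hg.leadingCoeff_pos 0
    simp only [Matrix.cons_val_fin_one, leadingCoeff, hdeg] at h
    rwa [ha_def]
  have hgeval : ∀ y : ℤ, g.eval y = a * y ^ 2 + b * y + c := fun y => by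
    rw [hquad, eval_quadPoly]
  -- a residue `t ∈ {0, 1}` with `g(t)` odd
  obtain ⟨t, ht2, ht⟩ : ∃ t : ℕ, t < 2 ∧ ¬ (2 : ℤ) ∣ g.eval (t : ℤ) := by
    by_contra! hcon
    have h2 := hg.hasNoFixedPrimeDivisor 2 Nat.prime_two
    have : 2 ≤ polyRootCountMod ![g] 2 := by
      unfold polyRootCountMod
      simp only [Fin.prod_univ_one, Matrix.cons_val_fin_one, Nat.cast_ofNat]
      rw [filter_true_of_mem fun n hn => hcon n (mem_range.mp hn), card_range]
    omega
  -- the shift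
  set M : ℕ := b.natAbs + c.natAbs + 1 with hM
  refine ⟨t + 2 * M, ?_, ?_⟩
  · intro h
    have hsub : ((t + 2 * M : ℕ) : ℤ) - (t : ℤ) ∣ g.eval ((t + 2 * M : ℕ) : ℤ) - g.eval (t : ℤ) :=
      sub_dvd_eval_sub _ _ g
    have h2 : (2 : ℤ) ∣ ((t + 2 * M : ℕ) : ℤ) - (t : ℤ) := ⟨M, by push_cast; ring⟩
    have h3 := dvd_sub h (h2.trans hsub)
    rw [sub_sub_cancel] at h3
    exact ht h3
  · intro m hm
    rw [hgeval]
    have hMm : (|b| + |c| + 1 : ℤ) ≤ m := by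
      have hM' : ((M : ℕ) : ℤ) = |b| + |c| + 1 := by
        simp only [hM, Nat.cast_add, Nat.cast_one, Int.natCast_natAbs]
      have : ((M : ℕ) : ℤ) ≤ m := le_trans (by push_cast; linarith) hm
      linarith
    have hm0 : 0 ≤ m := by linarith [abs_nonneg b, abs_nonneg c]
    have hm1 : 1 ≤ m := by linarith [abs_nonneg b, abs_nonneg c]
    have hsq : m ^ 2 ≤ a * m ^ 2 := by nlinarith [sq_nonneg m]
    have hbm : -(|b| * m) ≤ b * m := by nlinarith [neg_abs_le b]
    nlinarith [neg_abs_le c, mul_nonneg hm0 (sub_nonneg.mpr hMm),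
      mul_nonneg (abs_nonneg c) (sub_nonneg.mpr hm1)]

/-! ### `π_g(N) ≤ (2 C(g) + δ) N / log N` for every quadratic Bateman–Horn polynomial -/

/-- **The classical upper bound for the prime values of a quadratic polynomial.** For `g ∈ ℤ[X]` of
degree `2` forming a Bateman–Horn system and every `δ > 0`:
`π_g(N) ≤ (2 C(g) + δ) N / log N` for all large `N` — four times the Bateman–Horn prediction
`C(g) N /(2 log N)` (Halberstam–Richert Thm 5.3, `g = 2`; here from the Jurkat–Richert bound with
`F(1) = 2e^γ` at sieving level `z = N^c`, `c → 1`, `ε → 0`, applied to a good translate of `g`). -/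
theorem eventually_polyPrimeCount_le_of_natDegree_two {g : ℤ[X]} (hg : IsBatemanHornSystem ![g])
    (hdeg : g.natDegree = 2) {δ : ℝ} (hδ : 0 < δ) :
    ∀ᶠ N : ℕ in atTop,
      (polyPrimeCount ![g] N : ℝ) ≤ (2 * batemanHornConst ![g] + δ) * N / Real.log N := by
  -- the data of `g` and its translate `f(X) = g(X + n₀) = aX² + b'X + c'`
  obtain ⟨𝔠, h𝔠def⟩ : ∃ 𝔠 : ℝ, 𝔠 = batemanHornConst ![g] := ⟨_, rfl⟩
  have h𝔠 : 0 < 𝔠 := by rw [h𝔠def]; exact (IsBatemanHornSystem.hasBatemanHornConst_holds hg).2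
  rw [← h𝔠def]
  have hirr : Irreducible g := by simpa using hg.irreducible 0
  obtain ⟨a, ha_def⟩ : ∃ a : ℤ, a = g.coeff 2 := ⟨_, rfl⟩
  obtain ⟨b, hb_def⟩ : ∃ b : ℤ, b = g.coeff 1 := ⟨_, rfl⟩
  obtain ⟨c₀, hc_def⟩ : ∃ c₀ : ℤ, c₀ = g.coeff 0 := ⟨_, rfl⟩
  have hquad : g = quadPoly a b c₀ := by
    rw [ha_def, hb_def, hc_def]; exact eq_quadratic_of_natDegree_le_two g hdeg.le
  have ha : 0 < a := by
    have h := hg.leadingCoeff_pos 0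
    simp only [Matrix.cons_val_fin_one, leadingCoeff, hdeg] at h
    rwa [ha_def]
  have hgeval : ∀ y : ℤ, g.eval y = a * y ^ 2 + b * y + c₀ := fun y => by
    rw [hquad, eval_quadPoly]
  obtain ⟨n₀, hn₀odd, hlow⟩ := exists_oddShift_of_natDegree_two hg hdeg
  obtain ⟨f, hf⟩ : ∃ f : ℤ[X], f = quadPoly a (2 * a * n₀ + b) (a * (n₀ : ℤ) ^ 2 + b * n₀ + c₀) :=
    ⟨_, rfl⟩
  have hfeq : g.comp (X + C (n₀ : ℤ)) = f := Polynomial.funext fun r => by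
    rw [eval_comp, eval_add, eval_X, eval_C, hgeval, hf, eval_quadPoly]; ring
  have hfeval : ∀ m : ℤ, f.eval m = g.eval (m + n₀) := fun m => by
    rw [← hfeq, eval_comp, eval_add, eval_X, eval_C]
  have hfirr : Irreducible f := hfeq ▸ irreducible_comp_X_add_C hirr (n₀ : ℤ)
  have hρ : ∀ p : ℕ, polyRootCountMod ![f] p = polyRootCountMod ![g] p := fun p => by
    rw [← hfeq]; exact polyRootCountMod_comp_X_add_C g (n₀ : ℤ) p
  have hc'odd : Odd (a * (n₀ : ℤ) ^ 2 + b * n₀ + c₀) :=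
    Int.not_even_iff_odd.mp (by rw [even_iff_two_dvd, ← hgeval]; exact hn₀odd)
  have hfirr' : Irreducible (quadPoly a (2 * a * n₀ + b) (a * (n₀ : ℤ) ^ 2 + b * n₀ + c₀)) := hf ▸ hfirr
  have hval : ∀ n : ℕ, 1 ≤ n → (n : ℤ) ≤ f.eval (n : ℤ) := by
    intro n hn
    rw [hfeval]
    have h := hlow ((n : ℤ) + n₀) (by linarith [(Nat.cast_nonneg n : (0 : ℤ) ≤ n)])
    linarith [(Nat.cast_nonneg n₀ : (0 : ℤ) ≤ n₀)]
  have hlt : ∀ p : ℕ, p.Prime → polyRootCountMod ![f] p < p := fun p hp => by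
    rw [hρ]
    have h := rootCount_single_lt hg 0 hp
    simp only [Matrix.cons_val_fin_one] at h
    exact h
  -- `π_g(N) ≤ #{1 ≤ n ≤ N : |f(n)| prime} + n₀ + 1`
  have hcount : ∀ N : ℕ, (polyPrimeCount ![g] N : ℝ) ≤
      #((Icc 1 N).filter fun n : ℕ => Nat.Prime (f.eval (n : ℤ)).natAbs) + (n₀ + 1) := by
    intro N
    have h : polyPrimeCount ![g] N ≤
        #((Icc 1 N).filter fun n : ℕ => Nat.Prime (f.eval (n : ℤ)).natAbs) + (n₀ + 1) := by
      unfold polyPrimeCount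
      simp only [Fin.forall_fin_one, Matrix.cons_val_fin_one]
      calc #((range (N + 1)).filter fun n : ℕ => 0 < g.eval (n : ℤ) ∧ Nat.Prime (g.eval (n : ℤ)).toNat)
          ≤ #((((Icc 1 N).filter fun n : ℕ => Nat.Prime (f.eval (n : ℤ)).natAbs).image
                fun m : ℕ => m + n₀) ∪ range (n₀ + 1)) := by
            refine card_le_card fun n hn => ?_
            rw [mem_filter, mem_range] at hn
            obtain ⟨hnN, hpos, hprime⟩ := hn
            rw [mem_union, mem_image, mem_range]
            rcases Nat.lt_or_ge n (n₀ + 1) with h | h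
            · exact Or.inr h
            · refine Or.inl ⟨n - n₀, mem_filter.mpr ⟨mem_Icc.mpr ⟨by omega, by omega⟩, ?_⟩, by omega⟩
              have hcast : ((n - n₀ : ℕ) : ℤ) + n₀ = n := by
                rw [Nat.cast_sub (by omega : n₀ ≤ n)]; ring
              rw [hfeval, hcast]
              have h' : (g.eval (n : ℤ)).toNat = (g.eval (n : ℤ)).natAbs := by omega
              rwa [h'] at hprime
        _ ≤ #(((Icc 1 N).filter fun n : ℕ => Nat.Prime (f.eval (n : ℤ)).natAbs).image
                fun m : ℕ => m + n₀) + #(range (n₀ + 1)) := card_union_le _ _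
        _ ≤ _ := by rw [card_range]; exact Nat.add_le_add_right card_image_le _
    exact_mod_cast h
  -- parameters: level exponent `c`, sieve parameter `ε`, slack `η`
  obtain ⟨c, hcdef⟩ : ∃ c : ℝ, c = 16 * 𝔠 / (16 * 𝔠 + δ) := ⟨_, rfl⟩
  have hc0 : 0 < c := by rw [hcdef]; positivity
  have hc1 : c < 1 := by rw [hcdef, div_lt_one (by positivity)]; linarith
  have hSc : 𝔠 * c⁻¹ = 𝔠 + δ / 16 := by rw [hcdef, inv_div]; field_simp
  obtain ⟨ε, hεdef⟩ : ∃ ε : ℝ, ε = min (1 / 400) (δ / (Real.exp 13 * (16 * 𝔠 + δ))) := ⟨_, rfl⟩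
  have hε : 0 < ε := by rw [hεdef]; exact lt_min (by norm_num) (by positivity)
  have hε' : ε < 1 / 200 := by rw [hεdef]; exact (min_le_left _ _).trans_lt (by norm_num)
  have hε13 : ε * Real.exp 13 * (𝔠 + δ / 16) ≤ δ / 16 := by
    have h1 : ε ≤ δ / (Real.exp 13 * (16 * 𝔠 + δ)) := by rw [hεdef]; exact min_le_right _ _
    calc ε * Real.exp 13 * (𝔠 + δ / 16)
        ≤ δ / (Real.exp 13 * (16 * 𝔠 + δ)) * Real.exp 13 * (𝔠 + δ / 16) := by gcongr
      _ = δ / 16 := by field_simp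
  have hcoef0 : 0 < 2 * Real.exp Real.eulerMascheroniConstant + ε * Real.exp 13 := by positivity
  obtain ⟨η, hηdef⟩ : ∃ η : ℝ,
      η = δ / (8 * (2 * Real.exp Real.eulerMascheroniConstant + ε * Real.exp 13)) := ⟨_, rfl⟩
  have hη : 0 < η := by rw [hηdef]; positivity
  -- the data: Mertens hypothesis (from the sieve condition for `ρ_f`), mean value of `ρ`, Mertens product
  obtain ⟨K, hK1, hK⟩ := rhoG_sieveConditionOne ha hc'odd hfirr'
  have hK' : ∀ w z : ℝ, 2 ≤ w → w < z →
      ∏ p ∈ (Nat.primesBelow ⌈z⌉₊).filter (fun p : ℕ => w ≤ (p : ℝ)),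
          (1 - (polyRootCountMod ![f] p : ℝ) / p)⁻¹ ≤ Real.log z / Real.log w * (1 + K / Real.log w) := by
    intro w z hw hwz
    have h := hK w z hw hwz
    simp only [rhoG] at h
    rw [← hf] at h
    exact h
  obtain ⟨u₁, -, hMert⟩ := exists_hasMertensHypothesisBelow_polyAPSeq f hK1 hK' hε
  obtain ⟨C, hC0, hC⟩ := exists_sum_rootCount_le hirr (by rw [hdeg]; norm_num)
  have hCf : ∀ y : ℝ, 2 ≤ y → ∑ m ∈ Icc 1 ⌊y⌋₊, (polyRootCountMod ![f] m : ℝ) ≤ C * y := by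
    intro y hy; simp only [hρ]; exact hC y hy
  obtain ⟨Pu, hPudef⟩ : ∃ Pu : ℕ, Pu = ∏ p ∈ Nat.primesBelow ⌈u₁⌉₊, p := ⟨_, rfl⟩
  have hPu1 : (1 : ℝ) ≤ Pu := by
    rw [hPudef]; exact_mod_cast prod_pos fun p hp => (Nat.mem_primesBelow.mp hp).2.pos
  have hEγ : Real.exp Real.eulerMascheroniConstant * Real.exp (-Real.eulerMascheroniConstant) = 1 := by
    rw [← Real.exp_add, add_neg_cancel, Real.exp_zero]
  have hEγ1 : Real.exp (-Real.eulerMascheroniConstant) ≤ 1 := by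
    rw [Real.exp_le_one_iff]
    have := Real.one_half_lt_eulerMascheroniConstant
    linarith
  have hVle : ∀ᶠ N : ℕ in atTop, Real.log N *
      ∏ p ∈ Nat.primesBelow ⌈(N : ℝ) ^ c⌉₊, (1 - (polyRootCountMod ![g] p : ℝ) / p) ≤
        𝔠 * Real.exp (-Real.eulerMascheroniConstant) * c⁻¹ + η := by
    have h := tendsto_log_mul_prod_one_sub_rootCount_div_rpow hg hc0
    rw [← h𝔠def] at h
    exact h.eventually_le_const (by linarith)
  -- the main-term constant: `(2e^γ + ε e^{13}) (𝔠 e^{-γ}/c + η) ≤ 2𝔠 + 5δ/16`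
  have hcoefB : (2 * Real.exp Real.eulerMascheroniConstant + ε * Real.exp 13) *
      (𝔠 * Real.exp (-Real.eulerMascheroniConstant) * c⁻¹ + η) ≤ 2 * 𝔠 + 5 * δ / 16 := by
    have h1 : (2 * Real.exp Real.eulerMascheroniConstant + ε * Real.exp 13) *
        (𝔠 * Real.exp (-Real.eulerMascheroniConstant) * c⁻¹ + η)
        = 2 * (𝔠 * c⁻¹) *
            (Real.exp Real.eulerMascheroniConstant * Real.exp (-Real.eulerMascheroniConstant))
          + ε * Real.exp 13 * (𝔠 * c⁻¹) * Real.exp (-Real.eulerMascheroniConstant)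
          + (2 * Real.exp Real.eulerMascheroniConstant + ε * Real.exp 13) * η := by ring
    have h2 : (2 * Real.exp Real.eulerMascheroniConstant + ε * Real.exp 13) * η = δ / 8 := by
      rw [hηdef]; field_simp
    rw [h1, hEγ, hSc, h2]
    have h3 : ε * Real.exp 13 * (𝔠 + δ / 16) * Real.exp (-Real.eulerMascheroniConstant) ≤ δ / 16 * 1 :=
      mul_le_mul hε13 hEγ1 (Real.exp_pos _).le (by positivity)
    linarith
  -- the remainder and the shift are `o(N / log N)`: `log N ≤ α N^{1-c}` eventually
  have hCP : 0 < C * Pu + (n₀ + 2) := by positivity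
  obtain ⟨α, hαdef⟩ : ∃ α : ℝ, α = δ / (2 * (C * Pu + (n₀ + 2))) := ⟨_, rfl⟩
  have hα : 0 < α := by rw [hαdef]; positivity
  have hαid : (C * Pu + (n₀ + 2)) * α = δ / 2 := by rw [hαdef]; field_simp
  have hlog : ∀ᶠ N : ℕ in atTop, Real.log N ≤ α * (N : ℝ) ^ (1 - c) := by
    have h := (isLittleO_log_rpow_atTop (by linarith : (0 : ℝ) < 1 - c)).bound hα
    filter_upwards [tendsto_natCast_atTop_atTop.eventually h, eventually_ge_atTop 1] with N hN hN1
    have hN' : (1 : ℝ) ≤ N := by exact_mod_cast hN1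
    rwa [Real.norm_of_nonneg (Real.log_nonneg hN'),
      Real.norm_of_nonneg (Real.rpow_nonneg (by linarith) _)] at hN
  have hz2 : ∀ᶠ N : ℕ in atTop, (2 : ℝ) ≤ (N : ℝ) ^ c :=
    ((tendsto_rpow_atTop hc0).comp tendsto_natCast_atTop_atTop).eventually_ge_atTop 2
  filter_upwards [hVle, hlog, hz2, eventually_ge_atTop 2] with N hVN hlogN hz hN2
  have hN : (2 : ℝ) ≤ N := by exact_mod_cast hN2
  have hN0 : (0 : ℝ) < N := by linarith
  have hlog0 : 0 < Real.log N := Real.log_pos (by linarith)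
  have h := card_primeValues_le_sieve f hlt hval hε hε' hz N (hMert N _) hCf
  rw [← hPudef] at h
  simp only [hρ] at h
  have hcN := hcount N
  have hz1 : ((n₀ : ℝ) + 1) ≤ ((n₀ : ℝ) + 1) * (N : ℝ) ^ c :=
    le_mul_of_one_le_right (by positivity) (by linarith)
  rw [le_div_iff₀ hlog0]
  have hsplit : (N : ℝ) ^ c * (N : ℝ) ^ (1 - c) = N := by
    rw [← Real.rpow_add hN0, add_sub_cancel, Real.rpow_one]
  calc (polyPrimeCount ![g] N : ℝ) * Real.log N
      ≤ ((2 * Real.exp Real.eulerMascheroniConstant + ε * Real.exp 13) *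
            ((∏ p ∈ Nat.primesBelow ⌈(N : ℝ) ^ c⌉₊, (1 - (polyRootCountMod ![g] p : ℝ) / p)) * N)
          + C * ((N : ℝ) ^ c * Pu) + (N : ℝ) ^ c + ((n₀ : ℝ) + 1) * (N : ℝ) ^ c) * Real.log N := by
        apply mul_le_mul_of_nonneg_right _ hlog0.le
        linarith [h, hcN, hz1]
    _ = (2 * Real.exp Real.eulerMascheroniConstant + ε * Real.exp 13) *
            (Real.log N * ∏ p ∈ Nat.primesBelow ⌈(N : ℝ) ^ c⌉₊,
              (1 - (polyRootCountMod ![g] p : ℝ) / p)) * N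
          + (C * Pu + (n₀ + 2)) * ((N : ℝ) ^ c * Real.log N) := by ring
    _ ≤ (2 * Real.exp Real.eulerMascheroniConstant + ε * Real.exp 13) *
            (𝔠 * Real.exp (-Real.eulerMascheroniConstant) * c⁻¹ + η) * N
          + (C * Pu + (n₀ + 2)) * ((N : ℝ) ^ c * (α * (N : ℝ) ^ (1 - c))) := by
        gcongr
    _ = (2 * Real.exp Real.eulerMascheroniConstant + ε * Real.exp 13) *
            (𝔠 * Real.exp (-Real.eulerMascheroniConstant) * c⁻¹ + η) * N
          + (C * Pu + (n₀ + 2)) * α * N := by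
        rw [mul_left_comm ((N : ℝ) ^ c) α, hsplit]; ring
    _ ≤ (2 * 𝔠 + 5 * δ / 16) * N + δ / 2 * N := by
        rw [hαid]; gcongr
    _ ≤ (2 * 𝔠 + δ) * N := by
        have : 0 ≤ δ * N := by positivity
        linarith

end Summit.Parity.BatemanHorn.Theorems
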